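import Literature.NumberTheory.Sieve.LinearEquationsInPrimesEnvelopingSieveFacts
import Literature.NumberTheory.Sieve.LinearEquationsInPrimesPseudorandom
import HarnessLib

/-!
# The enveloping sieve: Green–Tao's measure `ν` and the assembly of Prop. 6.4 (Green–Tao 2010, App. D)

Trunk T-SIEVE (`Literature/NumberTheory/Sieve`). Part of the App. D layer of the decomposition of
`Literature.NumberTheory.Sieve.GreenTaoZiegler2012_finiteComplexity`, towards the discharge of the
named fact `Literature.NumberTheory.Sieve.GreenTao2010_pseudorandomDomination` (B. Green, T. Tao,
*Linear equations in primes*, Ann. of Math. 171 (2010), Prop. 6.4 "Domination by a pseudorandom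
measure", proved in App. D, pp. 47–48 of arXiv:math/0606088, "Construction of the enveloping
sieve").

The printed proof has four parts: (i) the construction of the measure — "We define the
preliminary weight `ν̃ : [N] → ℝ⁺` by setting `ν̃(n) := 𝔼_{i ∈ [t]} (φ(W)/W) Λ_{χ,R,2}(Wn + bᵢ)`
and then transfer this to `ℤ_{N'}` by setting `ν(n) := ½ + ½ ν̃(n)` when `n ∈ [N]` and
`ν(n) := 1` otherwise" (`R = N^γ`, `γ = γ(C,D)`); (ii) the pointwise bounds — "it suffices to show
that `Λ'_{bᵢ,W}(n) ≪_{C,D} (φ(W)/W) Λ_{χ,R,2}(Wn + bᵢ)` for all `i ∈ [t]` and `n ∈ [N^{3/5}, N]`.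
The left-hand side is only non-zero when `Wn + bᵢ` is a prime which is greater than `N^{3/5}`.
Supposing that `γ < 3/5`, we see that in this case the left-hand side is equal to
`(φ(W)/W) log N` [sc. `≤`: it is `(φ(W)/W) log(Wn + bᵢ)`], while the right-hand side is
`(φ(W)/W) log R`"; (iii) "Let us first verify the `(D,D,D)`-linear forms condition";
(iv) "Now we verify the `D`-correlation condition for `ν`".

This file formalises (i) (`Literature.NumberTheory.Sieve.gtPreMeasure`,
`Literature.NumberTheory.Sieve.gtMeasure`), PROVES (ii)
(`Literature.NumberTheory.Sieve.gtMeasure_dominates`), vendors (iii) and (iv) — the two remaining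
claims of the printed proof about this explicit measure — as the named facts
`Literature.NumberTheory.Sieve.GreenTao2010_envelopingSieve_linearFormsCondition` and
`Literature.NumberTheory.Sieve.GreenTao2010_envelopingSieve_correlationCondition`, and PROVES the
assembly
`Literature.NumberTheory.Sieve.GreenTao2010_pseudorandomDomination_of_envelopingSieveMeasure`:
(iii) and (iv) imply `GreenTao2010_pseudorandomDomination` (with `C₀ = 2`, `γ = γ(C,D)` the
smaller of the two exponents, `M = 2 + 6 t c_{χ,2} / γ`, and the cutoff `χ` the tree's standard
bump `Literature.NumberTheory.Sieve.GreenTao2008.stdBump`). The two facts are, in turn, what the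
displays vendored in `LinearEquationsInPrimesEnvelopingSieveFacts.lean` ((D.8) and the correlation
estimate) are for; their derivation from those displays (decomposition of `ν`, unwrapping `ℤ_{N'}`,
lattice-point counting, the coincident-shift case and the moment bounds for `τ`) is left to the
sibling `…Proofs` files of this layer.

## Rendering

* The sieve factor. The source fixes `χ` with `χ(0) = 1` and `∫₀¹ |χ'|² = 1`, so that
  `c_{χ,2} = 1` (Lemma D.2); as recorded in `…EnvelopingSieveFacts.lean`, no smooth `χ`
  supported on `[-1,1]` has both, so we keep `c = c_{χ,2} = ∫₀^∞ χ'²`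
  (`GreenTao2008.cChi χ > 0`) and normalise the preliminary weight by it:
  `ν̃(n) = 𝔼_{i ∈ [t]} (φ(W)/W) Λ_{χ,R,2}(Wn + bᵢ) / c`. This is the printed `ν̃` for the
  printed (impossible) normalisation and is what makes the linear forms averages equal to
  `1 + o(1)` rather than `c^m + o(1)`.
* `[N] ⊂ ℤ_{N'}` "in the obvious manner": `N' ≥ CN ≥ 2N > N` (we take `C₀ = 2`), and a residue
  `x` is in `[N]` iff its least non-negative representative `x.val` is; `ν̃` is read there.
  `Λ_{χ,R,2}` is defined on all of `ℤ` (`truncDivisorSum χ R 2`), so `ν̃` is a function on `ℤ`.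
* Quantifiers follow `GreenTao2010_pseudorandomDomination` (`…Pseudorandom.lean`) and the two
  displays (`…EnvelopingSieveFacts.lean`): `γ ≤ γ₀(C, D, t, χ)` ("`γ = γ(C,D)` to be chosen
  later"), the cutoff `w` range-uniform (`w₀ ≤ w ≤ ½ log log N`), `W = primorial w`, residues
  `bᵢ ∈ [W]` coprime to `W`, `N' ∈ [CN, 2CN]` prime, thresholds `w₀, N₀` depending on everything
  before them, the moment constants `A` of the correlation condition independent of `N, w, b, N'`.
* The pointwise bound is proved with the explicit constant `3/γ` per form (`Wn + bᵢ ≤ N³` for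
  `N ≥ 2`, using `W ≤ N` from `w ≤ ½ log log N`), whence `M = 2 + 6 t c / γ`.

## References

* B. Green, T. Tao, *Linear equations in primes*, Ann. of Math. (2) 171 (2010), 1753–1850
  (arXiv:math/0606088): Prop. 6.4, Defs. 6.1–6.3, App. D ("Construction of the enveloping sieve",
  pp. 47–48: the definition of `ν̃`, `ν`, the pointwise bounds, "Let us first verify the
  `(D,D,D)`-linear forms condition", "Now we verify the `D`-correlation condition for `ν`"), the
  Remark before the proof of Thm. D.3 ("`0 ≤ Λ'(n) ≤ (1/(γ χ(0)²)) Λ_{χ,R,2}(n)` for all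
  `R < n ≤ N`"), Lemma D.2.
* B. Green, T. Tao, *The primes contain arbitrarily long arithmetic progressions*, Ann. of
  Math. (2) 167 (2008), 481–547, Prop. 9.8 and Lemma 9.4 (the ancestors of the construction and
  of the pointwise bound), for comparison.
-/

noncomputable section

open Finset

namespace Literature.NumberTheory.Sieve

variable {t : ℕ}

/-! ### The measure (Green–Tao 2010, App. D, proof of Prop. 6.4) -/

/-- Green–Tao's preliminary weight `ν̃(n) = 𝔼_{i ∈ [t]} (φ(W)/W) Λ_{χ,R,2}(Wn + bᵢ)`, `R = N^γ`,
`W = ∏_{p ≤ w} p`, normalised by the sieve factor `c = c_{χ,2}` (module docstring; the source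
takes `c = 1`), as a function on all of `ℤ` (`Λ_{χ,R,2}` is periodic). Junk `0` for `t = 0`.
[cite: GreenTao2010, App. D (proof of Prop. 6.4, definition of `ν̃`)] -/
def gtPreMeasure (χ : ℝ → ℝ) (γ : ℝ) (N w : ℕ) (b : Fin t → ℕ) (y : ℤ) : ℝ :=
  (Nat.totient (primorial w) : ℝ) / primorial w / (t * GreenTao2008.cChi χ) *
    ∑ i, truncDivisorSum χ ((N : ℝ) ^ γ) 2 ((primorial w : ℤ) * y + b i)

/-- Green–Tao's enveloping-sieve measure on `ℤ_{N'}`: "`ν(n) := ½ + ½ ν̃(n)` when `n ∈ [N]` and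
`ν(n) := 1` otherwise", a residue being identified with its representative in `[0, N')`
(`N' > N`). [cite: GreenTao2010, App. D (proof of Prop. 6.4, definition of `ν`)] -/
def gtMeasure (χ : ℝ → ℝ) (γ : ℝ) (N w : ℕ) (b : Fin t → ℕ) (N' : ℕ) (x : ZMod N') : ℝ :=
  if 1 ≤ x.val ∧ x.val ≤ N then 1 / 2 + gtPreMeasure χ γ N w b x.val / 2 else 1

/-! ### Elementary properties -/

/-- `Λ_{χ,R,2} ≥ 0` for `R ≥ 1` (a square times `log R ≥ 0`). [cite: GreenTao2010, App. D
(Remark after the definition of `Λ_{χ,R,a}`: "to correct for the rather unfortunate fact that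
`Λ_{χ,R,1}(n)` can be negative")] -/
theorem truncDivisorSum_two_nonneg (χ : ℝ → ℝ) {R : ℝ} (hR : 1 ≤ R) (n : ℤ) :
    0 ≤ truncDivisorSum χ R 2 n :=
  mul_nonneg (Real.log_nonneg hR) (sq_nonneg _)

/-- The sieve level `R = N^γ` is at least `1`. [folklore] -/
theorem one_le_rpow_level {N : ℕ} (hN : 1 ≤ N) {γ : ℝ} (hγ : 0 ≤ γ) : (1 : ℝ) ≤ (N : ℝ) ^ γ :=
  Real.one_le_rpow (by exact_mod_cast hN) hγ

/-- `ν̃ ≥ 0` ("By construction, `ν̃` is certainly non-negative").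
[cite: GreenTao2010, App. D (proof of Prop. 6.4)] -/
theorem gtPreMeasure_nonneg (χ : ℝ → ℝ) {γ : ℝ} (hγ : 0 ≤ γ) {N : ℕ} (hN : 1 ≤ N) (w : ℕ)
    (b : Fin t → ℕ) (y : ℤ) : 0 ≤ gtPreMeasure χ γ N w b y := by
  unfold gtPreMeasure
  refine mul_nonneg (div_nonneg (div_nonneg (Nat.cast_nonneg _) (Nat.cast_nonneg _))
    (mul_nonneg (Nat.cast_nonneg _) (GreenTao2008.cChi_nonneg χ))) ?_
  exact Finset.sum_nonneg fun i _ => truncDivisorSum_two_nonneg χ (one_le_rpow_level hN hγ) _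

/-- `ν ≥ ½`, in particular `ν` is a non-negative function on `ℤ_{N'}` (a "measure", Def. 6.1).
[cite: GreenTao2010, App. D (proof of Prop. 6.4) and Def. 6.1] -/
theorem half_le_gtMeasure (χ : ℝ → ℝ) {γ : ℝ} (hγ : 0 ≤ γ) {N : ℕ} (hN : 1 ≤ N) (w : ℕ)
    (b : Fin t → ℕ) (N' : ℕ) (x : ZMod N') : 1 / 2 ≤ gtMeasure χ γ N w b N' x := by
  unfold gtMeasure
  split_ifs
  · linarith [gtPreMeasure_nonneg χ hγ hN w b (x.val : ℤ)]
  · norm_num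

/-- `ν ≥ 0`. [cite: GreenTao2010, Def. 6.1] -/
theorem gtMeasure_nonneg (χ : ℝ → ℝ) {γ : ℝ} (hγ : 0 ≤ γ) {N : ℕ} (hN : 1 ≤ N) (w : ℕ)
    (b : Fin t → ℕ) (N' : ℕ) (x : ZMod N') : 0 ≤ gtMeasure χ γ N w b N' x :=
  le_trans (by norm_num) (half_le_gtMeasure χ hγ hN w b N' x)

/-- On `[N] ⊂ ℤ_{N'}` (`N < N'`) the measure is `½ + ½ ν̃`. [cite: GreenTao2010, App. D (proof
of Prop. 6.4, definition of `ν`)] -/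
theorem gtMeasure_natCast (χ : ℝ → ℝ) (γ : ℝ) {N : ℕ} (w : ℕ) (b : Fin t → ℕ) {N' : ℕ}
    [NeZero N'] (hNN' : N < N') {n : ℕ} (hn1 : 1 ≤ n) (hn2 : n ≤ N) :
    gtMeasure χ γ N w b N' (n : ZMod N') = 1 / 2 + gtPreMeasure χ γ N w b n / 2 := by
  have hval : (n : ZMod N').val = n := by
    rw [ZMod.val_natCast, Nat.mod_eq_of_lt (lt_of_le_of_lt hn2 hNN')]
  simp [gtMeasure, hval, hn1, hn2]

/-! ### The truncated divisor sum at a large prime -/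

/-- For a prime `p > R ≥ 1` only the divisor `e = 1` is `≤ R`:
`∑_{e | p, e ≤ R} μ(e) χ(log e / log R) = χ(0)`. [cite: GreenTao2010, App. D (Remark after the
definition of `Λ_{χ,R,a}`: "`Λ_{χ,R,a} = χ(0)^a log R` on almost primes")] -/
theorem moebiusDivisorSum_prime (χ : ℝ → ℝ) {R : ℝ} {p : ℕ} (hp : p.Prime) (hR : 1 ≤ R)
    (hpR : R < p) : moebiusDivisorSum χ R p = χ 0 := by
  unfold moebiusDivisorSum
  have hset : (Icc 1 ⌊R⌋₊).filter (fun e : ℕ => (e : ℤ) ∣ (p : ℤ)) = {1} := by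
    ext e
    simp only [mem_filter, mem_Icc, mem_singleton]
    constructor
    · rintro ⟨⟨-, h2⟩, he⟩
      have he' : e ∣ p := Int.natCast_dvd_natCast.1 he
      rcases (Nat.dvd_prime hp).1 he' with h | h
      · exact h
      · exfalso
        rw [h] at h2
        have h3 : (p : ℝ) ≤ ⌊R⌋₊ := by exact_mod_cast h2
        linarith [Nat.floor_le (show (0 : ℝ) ≤ R by linarith)]
    · rintro rfl
      exact ⟨⟨le_rfl, Nat.le_floor (by exact_mod_cast hR)⟩, by simp⟩
  rw [hset, sum_singleton]
  simp

/-- `Λ_{χ,R,2}(p) = χ(0)² log R` for a prime `p > R ≥ 1`. [cite: GreenTao2010, App. D (Remark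
after the definition of `Λ_{χ,R,a}`)] -/
theorem truncDivisorSum_two_prime (χ : ℝ → ℝ) {R : ℝ} {p : ℕ} (hp : p.Prime) (hR : 1 ≤ R)
    (hpR : R < p) : truncDivisorSum χ R 2 p = Real.log R * χ 0 ^ 2 := by
  rw [truncDivisorSum, moebiusDivisorSum_prime χ hp hR hpR]

/-! ### The pointwise bound (Green–Tao 2010, App. D, proof of Prop. 6.4) -/

/-- For `N ≥ 2` and a cutoff `w ≤ ½ log log N`: `W = ∏_{p ≤ w} p ≤ N`, hence
`W n + b ≤ N³` for `n ≤ N`, `b ≤ W`. [folklore] -/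
theorem primorial_mul_add_le_cube {N w n b : ℕ} (hN : 2 ≤ N)
    (hw : (w : ℝ) ≤ Real.log (Real.log N) / 2) (hn : n ≤ N) (hb : b ≤ primorial w) :
    primorial w * n + b ≤ N ^ 3 := by
  have hW : primorial w ≤ N := by exact_mod_cast primorial_le_of_le_logLog hN hw
  calc primorial w * n + b ≤ N * N + N := add_le_add (Nat.mul_le_mul hW hn) (hb.trans hW)
    _ ≤ N ^ 3 := by nlinarith

/-- **The pointwise bound, one form** ("it suffices to show that
`Λ'_{bᵢ,W}(n) ≪_{C,D} (φ(W)/W) Λ_{χ,R,2}(Wn + bᵢ)` for all `i ∈ [t]` and `n ∈ [N^{3/5}, N]`. The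
left-hand side is only non-zero when `Wn + bᵢ` is a prime which is greater than `N^{3/5}` …
in this case the left-hand side is [at most `(φ(W)/W) log(Wn+bᵢ) ≤ 3 (φ(W)/W) log N`], while
the right-hand side is `(φ(W)/W) log R`"), with the explicit constant `3/γ` for `R = N^γ`,
`0 < γ ≤ ½`, `χ(0) = 1`. [cite: GreenTao2010, App. D (proof of Prop. 6.4, pointwise bounds)] -/
theorem vonMangoldtW_le_truncDivisorSum {χ : ℝ → ℝ} (hχ0 : χ 0 = 1) {γ : ℝ} (hγ : 0 < γ)
    (hγ1 : γ ≤ 1 / 2) {N : ℕ} (hN : 2 ≤ N) {w : ℕ} (hw : (w : ℝ) ≤ Real.log (Real.log N) / 2)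
    {b : ℕ} (hb : b ≤ primorial w) {n : ℕ} (hn1 : (N : ℝ) ^ ((3 : ℝ) / 5) ≤ n) (hn2 : n ≤ N) :
    vonMangoldtW (primorial w) b n ≤
      3 / γ * ((Nat.totient (primorial w) : ℝ) / primorial w *
        truncDivisorSum χ ((N : ℝ) ^ γ) 2 ((primorial w : ℤ) * n + b)) := by
  have hN1 : (1 : ℝ) < N := by exact_mod_cast hN
  have hN0 : (0 : ℝ) < N := by linarith
  have hR1 : (1 : ℝ) ≤ (N : ℝ) ^ γ := one_le_rpow_level (by omega) hγ.le
  have hφ0 : 0 ≤ (Nat.totient (primorial w) : ℝ) / primorial w := by positivity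
  have hcast : ((primorial w : ℤ) * n + b : ℤ) = ((primorial w * n + b : ℕ) : ℤ) := by push_cast; ring
  rw [hcast]
  by_cases hp : (primorial w * n + b).Prime
  · -- `W n + b = p` prime, `p > n ≥ N^{3/5} > N^γ = R`
    have hW1 : 1 ≤ primorial w := primorial_pos w
    have hnp : n ≤ primorial w * n + b := by nlinarith
    have hRlt : (N : ℝ) ^ γ < (primorial w * n + b : ℕ) := by
      have h1 : (N : ℝ) ^ γ < (N : ℝ) ^ ((3 : ℝ) / 5) :=
        Real.rpow_lt_rpow_of_exponent_lt hN1 (by linarith)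
      have h2 : (n : ℝ) ≤ (primorial w * n + b : ℕ) := by exact_mod_cast hnp
      linarith
    rw [truncDivisorSum_two_prime χ hp hR1 hRlt, hχ0, one_pow, mul_one,
      Real.log_rpow hN0]
    unfold vonMangoldtW
    rw [vonMangoldtPrime_prime hp, ArithmeticFunction.vonMangoldt_apply_prime hp]
    -- `log p ≤ 3 log N`
    have hp3 : Real.log ((primorial w * n + b : ℕ) : ℝ) ≤ 3 * Real.log N := by
      have h3 : (3 : ℝ) * Real.log N = Real.log ((N : ℝ) ^ 3) := by
        rw [Real.log_pow]; norm_num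
      rw [h3]
      refine Real.log_le_log (by exact_mod_cast hp.pos) ?_
      exact_mod_cast primorial_mul_add_le_cube hN hw hn2 hb
    have hlog0 : 0 ≤ Real.log N := Real.log_nonneg hN1.le
    calc (Nat.totient (primorial w) : ℝ) / primorial w * Real.log ((primorial w * n + b : ℕ) : ℝ)
        ≤ (Nat.totient (primorial w) : ℝ) / primorial w * (3 * Real.log N) :=
          mul_le_mul_of_nonneg_left hp3 hφ0
      _ = 3 / γ * ((Nat.totient (primorial w) : ℝ) / primorial w * (γ * Real.log N)) := by
          field_simp
  · -- not a prime: `Λ' = 0`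
    unfold vonMangoldtW
    rw [vonMangoldtPrime_of_not_prime hp, mul_zero]
    exact mul_nonneg (div_nonneg (by norm_num) hγ.le)
      (mul_nonneg hφ0 (truncDivisorSum_two_nonneg χ hR1 _))

/-- **The pointwise bound of Prop. 6.4 for Green–Tao's measure** (App. D, proof of Prop. 6.4:
"To verify the pointwise bounds, it suffices to show that
`Λ'_{bᵢ,W}(n) ≪_{C,D} (φ(W)/W) Λ_{χ,R,2}(Wn + bᵢ)` for all `i ∈ [t]` and `n ∈ [N^{3/5}, N]`"):
`1 + Λ'_{b₁,W}(n) + ⋯ + Λ'_{b_t,W}(n) ≤ M ν(n)` on `[N^{3/5}, N]` with `M = 2 + 6 t c / γ`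
(`1 ≤ 2ν` and, by `vonMangoldtW_le_truncDivisorSum`, `∑ᵢ Λ'_{bᵢ,W}(n) ≤ (3/γ) t c ν̃(n) ≤ (6tc/γ) ν(n)`).
Hypotheses: `χ(0) = 1`, `c = c_{χ,2} > 0`, `0 < γ ≤ ½`, `N ≥ 2`, `w ≤ ½ log log N`, `N < N'`,
`bᵢ ≤ W`. [cite: GreenTao2010, Prop. 6.4 and App. D (proof of Prop. 6.4, pointwise bounds)] -/
theorem gtMeasure_dominates {χ : ℝ → ℝ} (hχ0 : χ 0 = 1) (hc : 0 < GreenTao2008.cChi χ) {γ : ℝ}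
    (hγ : 0 < γ) (hγ1 : γ ≤ 1 / 2) (ht : 1 ≤ t) {N : ℕ} (hN : 2 ≤ N) {w : ℕ}
    (hw : (w : ℝ) ≤ Real.log (Real.log N) / 2) {N' : ℕ} [NeZero N'] (hNN' : N < N')
    {b : Fin t → ℕ} (hb : ∀ i, b i ≤ primorial w) {n : ℕ} (hn1 : (N : ℝ) ^ ((3 : ℝ) / 5) ≤ n)
    (hn2 : n ≤ N) :
    1 + ∑ i, vonMangoldtW (primorial w) (b i) n ≤
      (2 + 6 * t * GreenTao2008.cChi χ / γ) * gtMeasure χ γ N w b N' (n : ZMod N') := by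
  set φW : ℝ := (Nat.totient (primorial w) : ℝ) / primorial w with hφW_def
  have hN1' : 1 ≤ N := by omega
  -- `n ≥ 1` since `N^{3/5} ≥ 1`
  have hn0 : 1 ≤ n := by
    have h1 : (1 : ℝ) ≤ (N : ℝ) ^ ((3 : ℝ) / 5) := one_le_rpow_level hN1' (by norm_num)
    have h2 : (1 : ℝ) ≤ n := h1.trans hn1
    exact_mod_cast h2
  rw [gtMeasure_natCast χ γ w b hNN' hn0 hn2]
  have hpre : 0 ≤ gtPreMeasure χ γ N w b n := gtPreMeasure_nonneg χ hγ.le hN1' w b n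
  -- the sum of the `Λ'` is at most `(3/γ) t c ν̃(n)`
  have ht0 : (0 : ℝ) < t := by exact_mod_cast ht
  have hsum : ∑ i, vonMangoldtW (primorial w) (b i) n ≤
      3 / γ * (t * GreenTao2008.cChi χ) * gtPreMeasure χ γ N w b n := by
    have hkey : 3 / γ * (t * GreenTao2008.cChi χ) * gtPreMeasure χ γ N w b n =
        ∑ i, 3 / γ * (φW * truncDivisorSum χ ((N : ℝ) ^ γ) 2 ((primorial w : ℤ) * n + b i)) := by
      unfold gtPreMeasure
      rw [Finset.mul_sum, Finset.mul_sum]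
      refine Finset.sum_congr rfl fun i _ => ?_
      rw [hφW_def]
      field_simp
    rw [hkey]
    exact Finset.sum_le_sum fun i _ =>
      vonMangoldtW_le_truncDivisorSum hχ0 hγ hγ1 hN hw (hb i) hn1 hn2
  -- assemble: `1 + (3/γ) t c ν̃ ≤ (2 + 6tc/γ)(½ + ½ ν̃)`
  have hexp : (2 + 6 * t * GreenTao2008.cChi χ / γ) * (1 / 2 + gtPreMeasure χ γ N w b n / 2) =
      1 + 3 / γ * (t * GreenTao2008.cChi χ) * gtPreMeasure χ γ N w b n +
        (gtPreMeasure χ γ N w b n + 3 * t * GreenTao2008.cChi χ / γ) := by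
    field_simp
    ring
  rw [hexp]
  have hextra : 0 ≤ gtPreMeasure χ γ N w b n + 3 * t * GreenTao2008.cChi χ / γ := by positivity
  linarith

/-! ### Named facts: the two pseudorandomness verifications of the printed proof -/

/-- **The enveloping-sieve measure obeys the linear forms condition** (Green–Tao 2010, App. D,
proof of Prop. 6.4, as printed: "It remains to show that `ν` is a `D`-pseudorandom measure. …
Let us first verify the `(D,D,D)`-linear forms condition. By decomposing `ν` up into its various
components as in [Green–Tao 2008], it certainly suffices to establish the somewhat general bound
`∑_{n ∈ K ∩ ℤ^d} ∏_{j ∈ [m]} ν̃(ψ_j(n)) = vol_d(K) + o(N^d)` …" — that display is (D.8),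
`GreenTao2010_envelopingSieve_linearForms`). Rendered for the explicit measure `gtMeasure`
(normalised by `c_{χ,2}`, module docstring) with the quantitative linear forms condition of
`…Pseudorandom.lean` (`LinearFormsCondition D D D η`): for `D ≥ 2`, `t ≥ 1`, `C ≥ 2` and a smooth
compact cutoff `χ` with `c_{χ,2} > 0` there is `γ₀ = γ₀(C,D,t,χ) > 0` such that for every
`0 < γ ≤ γ₀` and `η > 0`, for `N ≥ N₀`, `w₀ ≤ w ≤ ½ log log N`, every prime `N' ∈ [CN, 2CN]` and
all residues `bᵢ ∈ [W]` coprime to `W = ∏_{p ≤ w} p`, the measure `ν` on `ℤ_{N'}` built from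
`R = N^γ` obeys the `(D,D,D)`-linear forms condition with error `η`.
[cite: GreenTao2010, App. D (proof of Prop. 6.4, verification of the linear forms condition) and
Def. 6.2] -/
def GreenTao2010_envelopingSieve_linearFormsCondition : Prop :=
  ∀ (D t : ℕ), 2 ≤ D → 1 ≤ t → ∀ C : ℝ, 2 ≤ C →
    ∀ χ : ℝ → ℝ, IsSmoothCompactCutoff χ → 0 < GreenTao2008.cChi χ →
      ∃ γ₀ : ℝ, 0 < γ₀ ∧ ∀ γ : ℝ, 0 < γ → γ ≤ γ₀ → ∀ η : ℝ, 0 < η → ∃ w₀ N₀ : ℕ,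
        ∀ N : ℕ, N₀ ≤ N → ∀ w : ℕ, w₀ ≤ w → (w : ℝ) ≤ Real.log (Real.log N) / 2 →
          ∀ (N' : ℕ) [NeZero N'], N'.Prime → C * N ≤ (N' : ℝ) → (N' : ℝ) ≤ 2 * C * N →
            ∀ b : Fin t → ℕ,
              (∀ i, 1 ≤ b i ∧ b i ≤ primorial w ∧ Nat.Coprime (b i) (primorial w)) →
              LinearFormsCondition D D D η (gtMeasure χ γ N w b N')

/-- **The enveloping-sieve measure obeys the correlation condition** (Green–Tao 2010, App. D,
proof of Prop. 6.4, as printed: "Now we verify the `D`-correlation condition for `ν`. As before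
we can pass from `ν` to `ν̃`, and reduce to showing that
`∑_{n ∈ I} ∏_{j ∈ [m]} ν̃(n + h_j) ≪ N ∑_{1 ≤ j < j' ≤ m} τ(h_j - h_{j'})` for all `m = O_D(1)`, all
`h₁, …, h_m ∈ [N]`, and all intervals `I ⊆ [N]`, and where `τ : [-N,N] → ℝ⁺` obeys the moment
bounds `𝔼_{n ∈ [-N,N]} τ(n)^q ≪_q 1` for all `q > 0`. We may assume that no two of the `h_i`
are equal as in this case one can use crude divisor estimates, setting `τ(0)` to be moderately
large" — the reduced display being `GreenTao2010_envelopingSieve_correlations`, the moment bound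
`sum_exp_rough_le`). Rendered for the explicit measure `gtMeasure` with the quantitative
correlation condition of `…Pseudorandom.lean` (`CorrelationCondition D A`, moments `q ≥ 1`): for
`D ≥ 2`, `t ≥ 1`, `C ≥ 2` and a smooth compact cutoff `χ` with `c_{χ,2} > 0` there is
`γ₀ = γ₀(C,D,t,χ) > 0` such that for every `0 < γ ≤ γ₀` there are moment constants `A`
(independent of `N, w, b, N'`) and thresholds `w₀, N₀` such that for `N ≥ N₀`,
`w₀ ≤ w ≤ ½ log log N`, every prime `N' ∈ [CN, 2CN]` and all residues `bᵢ ∈ [W]` coprime to `W`,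
the measure `ν` on `ℤ_{N'}` built from `R = N^γ` obeys the `D`-correlation condition with
constants `A`. [cite: GreenTao2010, App. D (proof of Prop. 6.4, verification of the correlation
condition) and Def. 6.3] -/
def GreenTao2010_envelopingSieve_correlationCondition : Prop :=
  ∀ (D t : ℕ), 2 ≤ D → 1 ≤ t → ∀ C : ℝ, 2 ≤ C →
    ∀ χ : ℝ → ℝ, IsSmoothCompactCutoff χ → 0 < GreenTao2008.cChi χ →
      ∃ γ₀ : ℝ, 0 < γ₀ ∧ ∀ γ : ℝ, 0 < γ → γ ≤ γ₀ → ∃ A : ℕ → ℝ → ℝ, ∃ w₀ N₀ : ℕ,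
        ∀ N : ℕ, N₀ ≤ N → ∀ w : ℕ, w₀ ≤ w → (w : ℝ) ≤ Real.log (Real.log N) / 2 →
          ∀ (N' : ℕ) [NeZero N'], N'.Prime → C * N ≤ (N' : ℝ) → (N' : ℝ) ≤ 2 * C * N →
            ∀ b : Fin t → ℕ,
              (∀ i, 1 ≤ b i ∧ b i ≤ primorial w ∧ Nat.Coprime (b i) (primorial w)) →
              CorrelationCondition D A (gtMeasure χ γ N w b N')

/-! ### Assembly of Prop. 6.4 -/

/-- **Prop. 6.4 from the two verifications** (Green–Tao 2010, App. D, proof of Prop. 6.4, the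
whole of "Construction of the enveloping sieve"): with the standard bump `χ` (`χ(0) = 1`,
`c_{χ,2} > 0`), `C₀ = 2`, `γ = γ(C,D)` the smaller of the two exponents of the facts (and `≤ ½`),
`M = 2 + 6 t c_{χ,2} / γ` and the moment constants of the correlation fact, the measure
`gtMeasure` is `D`-pseudorandom with any prescribed error `η` for `N` large and dominates
`1 + Λ'_{b₁,W} + ⋯ + Λ'_{b_t,W}` on `[N^{3/5}, N]` (`gtMeasure_dominates`).
[cite: GreenTao2010, Prop. 6.4 and App. D (proof of Prop. 6.4)] -/
theorem GreenTao2010_pseudorandomDomination_of_envelopingSieveMeasure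
    (hLF : GreenTao2010_envelopingSieve_linearFormsCondition)
    (hCC : GreenTao2010_envelopingSieve_correlationCondition) :
    GreenTao2010_pseudorandomDomination := by
  intro D t hD ht
  refine ⟨2, two_pos, fun C hC => ?_⟩
  -- the cutoff
  obtain ⟨hχ, hχ0, hc⟩ := isSmoothCompactCutoff_stdBump
  set χ : ℝ → ℝ := (GreenTao2008.stdBump : ℝ → ℝ) with hχ_def
  set c : ℝ := GreenTao2008.cChi χ with hc_def
  -- the exponent `γ = γ(C, D)`
  obtain ⟨γ₁, hγ₁, hLF'⟩ := hLF D t hD ht C hC χ hχ hc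
  obtain ⟨γ₂, hγ₂, hCC'⟩ := hCC D t hD ht C hC χ hχ hc
  set γ : ℝ := min (min γ₁ γ₂) (1 / 2) with hγ_def
  have hγ : 0 < γ := lt_min (lt_min hγ₁ hγ₂) (by norm_num)
  have hγle₁ : γ ≤ γ₁ := (min_le_left _ _).trans (min_le_left _ _)
  have hγle₂ : γ ≤ γ₂ := (min_le_left _ _).trans (min_le_right _ _)
  have hγhalf : γ ≤ 1 / 2 := min_le_right _ _
  obtain ⟨A, w₂, N₂, hCC''⟩ := hCC' γ hγ hγle₂
  refine ⟨2 + 6 * t * c / γ, by positivity, A, fun η hη => ?_⟩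
  obtain ⟨w₁, N₁, hLF''⟩ := hLF' γ hγ hγle₁ η hη
  refine ⟨max w₁ w₂, max (max N₁ N₂) 2, fun N hN w hw hwN N' _ hN'p hCN hN'C b hb => ?_⟩
  have hN₁ : N₁ ≤ N := le_trans ((le_max_left _ _).trans (le_max_left _ _)) hN
  have hN₂ : N₂ ≤ N := le_trans ((le_max_right _ _).trans (le_max_left _ _)) hN
  have hN2 : 2 ≤ N := le_trans (le_max_right _ _) hN
  have hw₁ : w₁ ≤ w := le_trans (le_max_left _ _) hw
  have hw₂ : w₂ ≤ w := le_trans (le_max_right _ _) hw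
  -- `N < N'` since `N' ≥ C N ≥ 2 N`
  have hNN' : N < N' := by
    have h1 : (N : ℝ) < C * N := by
      have hN0 : (0 : ℝ) < N := by exact_mod_cast (show 0 < N by omega)
      nlinarith
    exact_mod_cast h1.trans_le hCN
  refine ⟨gtMeasure χ γ N w b N', ⟨fun x => gtMeasure_nonneg χ hγ.le (by omega) w b N' x,
    hLF'' N hN₁ w hw₁ hwN N' hN'p hCN hN'C b hb, hCC'' N hN₂ w hw₂ hwN N' hN'p hCN hN'C b hb⟩,
    fun n hn1 hn2 => ?_⟩
  exact gtMeasure_dominates hχ0 hc hγ hγhalf ht hN2 hwN hNN' (fun i => (hb i).2.1) hn1 hn2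

end Literature.NumberTheory.Sieve

end
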